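import Summits.QuantumFields.YangMills.Theorems.UnitScaleTiltHistoryTailLaneRows
import Summits.QuantumFields.YangMills.Theorems.UnitScaleTiltHistoryTailLaneNumerator
import Summits.QuantumFields.YangMills.Theorems.UnitScaleTiltHistoryTailPerPlaquetteV3b
import Summits.QuantumFields.YangMills.Theorems.UnitScaleTiltHistoryTailBoundedHeight
import HarnessLib

/-!
# Route `UnitScaleTilt` — crux K2-L `HistoryTailL` (stmt-QuantumFields-19936): **THE CRUX MODULO THE LANE'S (α) RECORD** — `historyTailL_of_laneRecords :
# (∀ L, Odd L → 1 < L → AlphaInputsT3ACv3Rec L) → …Theses.UnitScaleTilt.HistoryTailL` (fleet lead `ym-ust-18916-p1` g5; `--supports` 19936; part 3/3)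

The sorry-free cone of the registered-line skeleton v5p7 (5a70ea2d66d698c3) LANDED: for a primitive-constants record `𝔠` with family-uniform [7]-constants whose v3
(α) rows hold for every family of block size `L` (`∀ F hF, AlphaInputsT3AC.OfV3At F (hF ▸ 𝔠) a₀ a₁` — a HYPOTHESIS, the lane's END theorem / NODE O; never asserted),
`perPlaquetteHigh_lane` gives the per-plaquette large-field Gibbs tail `C·β^A·exp(−c·p(g)² + κ·x^{2+3r₀})` at the record's profile for every odd `L ≥ 3` (2″(b)
`smallFactorLane_v3` ← p514512, (c) p513495, (d) p511457, 2‴ `windowedWeights_v3`, 4c p515800, 4a p516492, 4b p511836, chessboard p481363, Mechanism A); then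
`perPlaquetteHighL_of_laneRecords` (threshold form) and **`historyTailL_of_laneRecords`**: v4's tail chain (`budget_of_c` → `stub_budget` p442213,
`perPlaquette_of_split` p438760, `stub_tailOfPerPlaquette` p432346, `historyTailAt_of_averagedTailAt`) ⇒ `HistoryTailL` GIVEN the record-parametric v3 socket
`AlphaInputsT3ACv3Rec L` for every odd `L > 1` — a CONDITIONAL closing of stmt-QuantumFields-19936 by name (the condition is the registered stub 2′ `stub_laneRecordsV3`).
Nothing of [Balaban1985UV3] is asserted. [cite: Balaban1985UV3, (5) p.256, (41) p.266, (47) p.267, (71) p.273 and Thm 2 p.272; King1986, (3.12) p.657]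
-/

set_option autoImplicit false

noncomputable section

open MeasureTheory
open Literature.MathematicalPhysics.QuantumFieldTheory.Balaban1983to89
open Literature.MathematicalPhysics.QuantumFieldTheory.Balaban1983to89.T3ContinuumYM3Torus
open Literature.MathematicalPhysics.QuantumFieldTheory.Balaban1983to89.T3UnitScaleTilt
open Literature.MathematicalPhysics.QuantumFieldTheory.Balaban1983to89.T3UnitLawDensityEML
open Literature.MathematicalPhysics.QuantumFieldTheory.Balaban1983to89.T3BareTailProfile
open Literature.MathematicalPhysics.QuantumFieldTheory.Balaban1983to89.T3ThresholdSmallness (sqrt_coupling_pos_le)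
open Literature.MathematicalPhysics.QuantumFieldTheory.Balaban1983to89.T3Thresholds (coupling_le_one)
open Literature.MathematicalPhysics.QuantumFieldTheory.Balaban1983to89.T3AlphaInputsAC
open Literature.MathematicalPhysics.QuantumFieldTheory.Balaban1983to89.T3AlphaInputsACSchemas
open Literature.MathematicalPhysics.QuantumFieldTheory.Balaban1983to89.B10Eq38TorusDomains (toFine)
open Literature.MathematicalPhysics.QuantumFieldTheory.Balaban1983to89.T3RestrictedUnitDensity (resDensity integrable_resDensity)
open Literature.MathematicalPhysics.QuantumFieldTheory.Balaban1983to89.Missing (partitionFn measurable_plaqHol)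
open Summit.QuantumFields.Balaban3D.Carriers (suGroupModel)
open Summit.QuantumFields.Balaban3D.Proofs.Primitives (AlphaConsts)
open Summit.QuantumFields.Balaban3D.Proofs.Run3SmallFactors (regionT src_mem_plaqCover_of_mem_regionT)
open Summit.QuantumFields.YangMills.Theorems
open Summit.QuantumFields.YangMills.Theorems.HistoryTailDensityTransfer (gibbsK_real_preimage_iter_eq)
open Summit.QuantumFields.YangMills.Theorems.HistoryTailSandwich (partitionFn_eq_integral_resDensity)
open Summit.QuantumFields.YangMills.Theorems.HistoryTailMechanismA (integral_mul_indicator_one_eq_setIntegral)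
open Summit.QuantumFields.YangMills.Theorems.HistoryTailAlphaConsumer (setIntegral_div_integral_le_ae)
open Summit.QuantumFields.YangMills.Theorems.HistoryTailLaneRows (laneRows_v3 windowedWeights_v5p5Shape)
open Summit.QuantumFields.YangMills.Theorems.HistoryTailLaneNumerator (gibbsK_real_iInter_le root_bound exponent_bound setIntegral_up_le xlog_mono mass_budget budget_of_c)

namespace Summit.QuantumFields.YangMills.Theorems.HistoryTailLaneTail

open Classical

/-- **THE PER-PLAQUETTE HIGH TAIL AT THE RECORD'S PROFILE, every odd `L ≥ 3`** (v4's `stub_perPlaquetteHighRaw` conclusion with `(b₀, p₀, r₀) := (𝔠.b₀, 𝔠.p₀, 𝔠.r₀)`): from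
ONE record `𝔠` with family-uniform [7]-constants (STUB 2′'s output at a profile) — the lane's deliverables (STUB 2″), the exponent bound (4c), the history mass
(4a), the minorant mass (4b), the LANDED chessboard `chessboardRP_T3`, Mechanism A on the joint event from the DELIVERED envelopes of the concrete datum, the
|S|-th root, the exponent algebra. [cite: Balaban1985UV3, (5) p.256, (41) p.266, (47) p.267 and (71) p.273] -/
theorem perPlaquetteHigh_lane (L : ℕ) (hLo : Odd L) (hL : 1 < L) (𝔠 : AlphaConsts L (suGroupModel 2).N) (a₀ a₁ : ℝ)
    (ha0 : 0 < a₀) (ha1 : 0 < a₁) (hw : 𝔠.B₃ * a₁ ≤ a₀)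
    (h𝔠 : ∀ (F : T3Family) (hF : F.L = L), AlphaInputsT3AC.OfV3At F (hF ▸ 𝔠) a₀ a₁) :
    ∃ κ γ₁ c : ℝ, 0 ≤ κ ∧ 0 < γ₁ ∧ γ₁ ≤ 1 ∧ 0 < c ∧ c ≤ 1 / 4 ∧
      ∀ (F : T3Family) (γ : ℝ), F.L = L → 0 < γ → γ ≤ γ₁ →
        ∃ (j₀ : ℕ) (C : ℝ) (A : ℕ), 0 ≤ C ∧
          ∀ (K j : ℕ), j₀ < j → j ≤ K → ∀ p : Plaq (F.P K) j,
            (gibbsK F ℰp γ K).real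
                {U | θBal F.L γ 𝔠.b₀ 𝔠.p₀ (K - j) ≤
                  GaugeGroup.dist1 (GaugeField.plaqHol
                    (Averaging.iter (fun _ => BlockAveraging.blockAvg ℰp) j U) p)} ≤
              C * (F.scheme ℰp γ).β (K - j) ^ A *
                Real.exp (-(c * B10.pFun 𝔠.b₀ 𝔠.p₀ (Real.sqrt (γ * ((F.L : ℝ)⁻¹) ^ (K - j))) ^ 2) +
                  κ * (1 + Real.log (Real.sqrt (γ * ((F.L : ℝ)⁻¹) ^ (K - j)))⁻¹) ^ (2 + 3 * 𝔠.r₀)) := by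
  -- the constants, all fixed with the record
  obtain ⟨γ₂, cSF, CP, κZ, hγ₂, hcSF0, hcSF4, hCP, hκZ, hLane⟩ := laneRows_v3 L hLo hL 𝔠 a₀ a₁ ha0 ha1 hw
  obtain ⟨γw, Bm, hγw, hBm, hWin⟩ := windowedWeights_v5p5Shape L hLo hL 𝔠 a₀ a₁ ha0 ha1 hw
  have hCT : (0 : ℝ) ≤ Bm := hBm
  set CT : ℝ := Bm with hCTdef
  obtain ⟨ccol, γc, hccol, hγc, h4c⟩ := Summit.QuantumFields.YangMills.Theorems.HistoryTailDiluteExponentCV3.diluteExponent_of_smallFactorIn L hLo hL 𝔠 a₀ a₁ ha0 ha1 hw cSF hcSF0 hcSF4 κZ hκZ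
  obtain ⟨CM, γa, hCM, hγa, h4a⟩ :=
    Summit.QuantumFields.YangMills.Theorems.HistoryTailHistoryMassWCV3.historyMassBound_of_weights_c L hLo hL 𝔠 a₀ a₁ ha0 ha1 hw CP hCP Bm hBm
      (cSF * 𝔠.b₀ ^ 2 / 50) (by have := 𝔠.b₀_pos; positivity)
  obtain ⟨CL, γb, hCL, hγb, h4b⟩ := Summit.QuantumFields.YangMills.Theorems.HistoryTailLowMassV3.stub_lowMass_of_one_lt L hLo hL 𝔠 a₀ a₁ ha0 ha1 hw CP hCP
  obtain ⟨γθ, hγθ, hγθ1, hθle⟩ := T3Thresholds.exists_gamma_forall_θBal_le 𝔠.b₀_pos 𝔠.p₀_pos one_pos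
  have hg0 : 0 < (min 𝔠.gamma0 1) ^ 2 := by have := 𝔠.gamma0_pos; positivity
  set C : ℝ := CM + CP + CT + CL + 1 with hCdef
  have hC0 : 0 ≤ C := by rw [hCdef]; positivity
  have hL0 : (0 : ℝ) ≤ (L : ℝ) := by positivity
  refine ⟨8 * C * (L : ℝ) ^ 3 * (ccol + 4) ^ 3,
    min (min (min (min γ₂ γw) γc) (min γa γb)) (min (min γθ ((min 𝔠.gamma0 1) ^ 2)) 1), cSF, by positivity,
    by positivity, (min_le_right _ _).trans (min_le_right _ _), hcSF0, hcSF4, fun F γ hFL hγ hle => ?_⟩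
  -- thresholds unpacked
  have hle2 : γ ≤ γ₂ := hle.trans ((min_le_left _ _).trans ((min_le_left _ _).trans ((min_le_left _ _).trans (min_le_left _ _))))
  have hlew : γ ≤ γw := hle.trans ((min_le_left _ _).trans ((min_le_left _ _).trans ((min_le_left _ _).trans (min_le_right _ _))))
  have hlec : γ ≤ γc := hle.trans ((min_le_left _ _).trans ((min_le_left _ _).trans (min_le_right _ _)))
  have hlea : γ ≤ γa := hle.trans ((min_le_left _ _).trans ((min_le_right _ _).trans (min_le_left _ _)))
  have hleb : γ ≤ γb := hle.trans ((min_le_left _ _).trans ((min_le_right _ _).trans (min_le_right _ _)))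
  have hleθ : γ ≤ γθ := hle.trans ((min_le_right _ _).trans ((min_le_left _ _).trans (min_le_left _ _)))
  have hleg : γ ≤ (min 𝔠.gamma0 1) ^ 2 := hle.trans ((min_le_right _ _).trans ((min_le_left _ _).trans (min_le_right _ _)))
  have hγ1 : γ ≤ 1 := hle.trans ((min_le_right _ _).trans (min_le_right _ _))
  subst hFL
  have hL1 : 1 ≤ F.L := F.hL.2.le
  -- the concrete datum of this family
  have hOf : AlphaInputsT3AC.OfV3At F 𝔠 a₀ a₁ := h𝔠 F rfl
  have hc : 0 < a₀ ∧ 0 < a₁ ∧ 𝔠.B₃ * a₁ ≤ a₀ := ⟨ha0, ha1, hw⟩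
  let π : AlphaInputsT3AC.PolymerT3 F := ⟨fun _ _ _ _ => ∅, fun _ _ _ _ => 0, fun _ _ Y => Y, fun _ _ _ => 0⟩
  obtain ⟨hSF, hPS, hZ⟩ := hLane F rfl hOf hc γ hγ hleg π hle2
  obtain ⟨wt', hw0, hwz, hwAdm, hwI, hPm, h41I⟩ := hWin F rfl hOf hc γ hγ hleg π hlew
  have hExp := h4c F rfl hOf hc γ hγ hleg π hlec hSF hZ
  have hMass := h4a F rfl hOf hc γ hγ hleg π (fun K j r _ Wf => wt' K j r Wf) hlea (fun K j r _ Wf => hw0 K j r Wf)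
    (fun K j r _ Wf hra => hwz K j r Wf hra) hPS (fun K j r _ hjK hne => hwAdm K j r hjK (Nat.one_le_iff_ne_zero.mpr fun hj0 => hne (by subst hj0; exact Summit.QuantumFields.Balaban3D.Carriers.Hist.eq_triv_zero r))) (fun K j r _ hjK => hwI K j r hjK)
    (fun K j r _ hjK => hPm K j r hjK)
  have hLow := h4b F rfl hOf hc γ hγ hleg π hleb hPS
  -- the datum with the windowed weights (regions, minimiser, main term, interaction, Zterm, χ, low, Rm unchanged)
  let D' : AlphaDataT3 F γ := { hOf.dataT3v3 hc γ hγ hleg π with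
    LF := fun K j Wf Φ => wt' K j (Summit.QuantumFields.Balaban3D.Carriers.Hist.triv (F.P K) j) Wf *
        Real.exp (Φ (Summit.QuantumFields.Balaban3D.Carriers.Hist.triv (F.P K) j)) +
      ∑ r ∈ Finset.univ.erase (Summit.QuantumFields.Balaban3D.Carriers.Hist.triv (F.P K) j),
        wt' K j r Wf * Real.exp (Φ r) }
  obtain ⟨CRm, hCRm⟩ := exp_two_Rm_le (hOf.dataT3v3_rmSize hc γ hγ hleg π)
  have hCRm0 : 0 ≤ CRm := (Real.exp_pos _).le.trans (hCRm 0 0 le_rfl)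
  refine ⟨0, max 1 CRm, 0, le_trans zero_le_one (le_max_left _ _), fun K j hj hjK p => ?_⟩
  have hj1 : 1 ≤ j := hj
  -- names for the scale-`K−j` quantities
  set g : ℝ := Real.sqrt (γ * ((F.L : ℝ)⁻¹) ^ (K - j)) with hg
  set x : ℝ := 1 + Real.log g⁻¹ with hx
  set θ : ℝ := θBal F.L γ 𝔠.b₀ 𝔠.p₀ (K - j) with hθ
  set N : ℝ := ((F.P K).sitesPerDir j : ℝ) with hN
  have hgpos : 0 < g := (sqrt_coupling_pos_le hL1 hγ (K - j)).1
  have hg1 : g ≤ 1 := coupling_le_one hL1 hγ hγ1 (K - j)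
  have hx1 : 1 ≤ x := by
    have : 0 ≤ Real.log g⁻¹ := Real.log_nonneg (one_le_inv_iff₀.mpr ⟨hgpos, hg1⟩)
    linarith
  have hr₀ : 0 ≤ 𝔠.r₀ := zero_le_one.trans 𝔠.one_le_r₀
  have hxr : 1 ≤ x ^ 𝔠.r₀ := Real.one_le_rpow hx1 hr₀
  have hN1 : 1 ≤ N := by
    rw [hN]; exact_mod_cast Nat.one_le_iff_ne_zero.mpr ((F.P K).sitesPerDir_ne_zero j)
  have hN3 : 1 ≤ N ^ 3 := one_le_pow₀ hN1
  have hxN : 1 ≤ x * N ^ 3 := one_le_mul_of_one_le_of_one_le hx1 hN3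
  -- the chessboard family at separation `ρ = ccol·x^{r₀}`
  have hρ1 : 1 ≤ ccol * x ^ 𝔠.r₀ := one_le_mul_of_one_le_of_one_le hccol hxr
  obtain ⟨S, hpS, hsep, hcount, hchess⟩ :=
    HistoryTailChessboardT3.chessboardRP_T3 F.L hLo hL F γ rfl hγ hγ1 θ K j hjK (ccol * x ^ 𝔠.r₀) hρ1 p
  have hcard : 1 ≤ S.card := Finset.card_pos.mpr ⟨p, hpS⟩
  -- the numerator bound: exponent (4c) + history mass (4a) + trivial mass (2″f) + minorant mass (4b)
  set P4 : ℝ := cSF * B10.pFun 𝔠.b₀ 𝔠.p₀ g ^ 2 with hP4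
  set σ : ℕ → ℝ := fun i => cSF * 𝔠.b₀ ^ 2 / 50 *
      (1 + Real.log (Real.sqrt (γ * ((F.L : ℝ)⁻¹) ^ (K - i)))⁻¹) ^ (2 * 𝔠.p₀ - 1) *
      ((1 + Real.log (Real.sqrt (γ * ((F.L : ℝ)⁻¹) ^ (K - i)))⁻¹) - (1 + Real.log (Real.sqrt (γ * ((F.L : ℝ)⁻¹) ^ (K - j)))⁻¹)) with hσdef
  have hσ0 : ∀ i, i < j → 0 ≤ σ i := by
    intro i hij
    have hxi : 1 ≤ 1 + Real.log (Real.sqrt (γ * ((F.L : ℝ)⁻¹) ^ (K - i)))⁻¹ := hx1.trans (xlog_mono F hγ hij.le)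
    have h1 : 0 ≤ (1 + Real.log (Real.sqrt (γ * ((F.L : ℝ)⁻¹) ^ (K - i)))⁻¹) ^ (2 * 𝔠.p₀ - 1) :=
      Real.rpow_nonneg (zero_le_one.trans hxi) _
    have h2 : 0 ≤ (1 + Real.log (Real.sqrt (γ * ((F.L : ℝ)⁻¹) ^ (K - i)))⁻¹) - (1 + Real.log (Real.sqrt (γ * ((F.L : ℝ)⁻¹) ^ (K - j)))⁻¹) :=
      sub_nonneg.mpr (xlog_mono F hγ hij.le)
    have hb : 0 ≤ cSF * 𝔠.b₀ ^ 2 / 50 := by have := hcSF0.le; positivity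
    exact mul_nonneg (mul_nonneg hb h1) h2
  let v₀ : (i : Fin j) → GaugeField (F.P K) i (Matrix.specialUnitaryGroup (Fin 2) ℂ) := fun _ => 1
  set Pz : ℝ := CP * θBal F.L γ 𝔠.b₀ 𝔠.p₀ (K - j + 1) ^ 2 * N ^ 3 with hPz
  have hθ1 : θBal F.L γ 𝔠.b₀ 𝔠.p₀ (K - j + 1) ≤ 1 := hθle F.L hL1 γ hγ hleθ (K - j + 1)
  have hθ0' : 0 ≤ θBal F.L γ 𝔠.b₀ 𝔠.p₀ (K - j + 1) :=
    (T3MinimiserStabilityReduction.θBal_pos hL1 hγ hγ1 𝔠.b₀_pos 𝔠.p₀ (K - j + 1)).le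
  have hPzle : Pz ≤ CP * (x * N ^ 3) := by
    have hsq : θBal F.L γ 𝔠.b₀ 𝔠.p₀ (K - j + 1) ^ 2 ≤ 1 := pow_le_one₀ hθ0' hθ1
    have hN30 : 0 ≤ N ^ 3 := zero_le_one.trans hN3
    calc Pz = CP * (θBal F.L γ 𝔠.b₀ 𝔠.p₀ (K - j + 1) ^ 2 * N ^ 3) := by rw [hPz]; ring
      _ ≤ CP * (1 * N ^ 3) := mul_le_mul_of_nonneg_left (mul_le_mul_of_nonneg_right hsq hN30) hCP
      _ ≤ CP * (x * N ^ 3) := mul_le_mul_of_nonneg_left (mul_le_mul_of_nonneg_right hx1 hN30) hCP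
  have h2le : Bm ≤ Real.exp (CT * x * N ^ 3) := by
    calc Bm ≤ Bm + 1 := by linarith
      _ ≤ Real.exp Bm := Real.add_one_le_exp Bm
      _ ≤ Real.exp (CT * x * N ^ 3) := Real.exp_le_exp.mpr (by rw [hCTdef]; nlinarith [hxN, hBm])
  have hnumer := setIntegral_up_le hOf hc γ hγ hleg π K j S θ P4 (Real.exp (CM * x * N ^ 3)) (Real.exp (CT * x * N ^ 3)) Pz σ hσ0
    (fun r Wf => wt' K j r Wf) (fun r Wf => hw0 K j r Wf)
    (AlphaDataT3.up D' K j) (wt' K j (Summit.QuantumFields.Balaban3D.Carriers.Hist.triv (F.P K) j))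
    (fun Wf => hw0 K j _ Wf) (fun Wf => rfl)
    (fun r Wf hadm hWE => hExp K j hjK r v₀ Wf hadm S hWE hsep)
    (fun r _ => hwAdm K j r hjK hj1) (hwAdm K j _ hjK hj1)
    (fun r Wf hadm => (abs_le.mp (hPS K j r Wf hjK hj1 hadm)).2)
    (hMass K j hjK v₀) ⟨(hwI K j _ hjK).1, (hwI K j _ hjK).2.trans h2le⟩
    (h41I K j hjK).2
  -- the bound `B` against `∫ low`
  have hlowmass : Real.exp (-(CL * x * N ^ 3)) ≤
      ∫ Wf, (hOf.dataT3v3 hc γ hγ hleg π).low K j Wf ∂fieldMeasure (F.P K) j (Matrix.specialUnitaryGroup (Fin 2) ℂ) := hLow K j hjK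
  have hB := mass_budget (c := (S.card : ℝ) * P4) hCM hCP hCT hxN hPzle hlowmass
  have hnum := hnumer.trans hB
  -- Mechanism A on the joint event from the DELIVERED envelopes
  have h47' : Ineq47AE D' K j := hOf.dataT3v3_ineq47AE hc γ hγ hleg π K j hjK
  have hreg' : EnvelopeRegular D' K j :=
    ⟨hOf.dataT3v3_integrable_low hc γ hγ hleg π K j hjK, (h41I K j hjK).2, hOf.dataT3v3_integral_low_pos hc γ hγ hleg π K j hjK⟩
  have hinter := gibbsK_real_iInter_le (D := D') hγ.le hjK (h41I K j hjK).1 h47' hreg'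
    (fun Wf => T3AlphaInputsAC.low_nonneg (hOf.dataT3v3_chiRange hc γ hγ hleg π) K j Wf) S θ _ hnum
  have hB2 : (gibbsK F ℰp γ K).real
        {U | ∀ q ∈ S, θ ≤ GaugeGroup.dist1 (GaugeField.plaqHol
          (Averaging.iter (fun _ => BlockAveraging.blockAvg ℰp) j U) q)} ≤
      CRm * Real.exp (-((S.card : ℝ) * P4) + (CM + CP + CT + CL + 1) * x * N ^ 3) :=
    hinter.trans (mul_le_mul_of_nonneg_right (hCRm K j hjK) (Real.exp_nonneg _))
  -- the root and the exponent
  have hE_eq : -((S.card : ℝ) * P4) + (CM + CP + CT + CL + 1) * x * N ^ 3 = -P4 * (S.card : ℝ) + C * x * N ^ 3 := by rw [hCdef]; ring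
  rw [hE_eq] at hB2
  have hroot := root_bound (E := -P4 * (S.card : ℝ) + C * x * N ^ 3) hcard measureReal_nonneg hCRm0 hchess hB2
  have hcount' : N ^ 3 ≤ (S.card : ℝ) * (8 * ((F.L : ℝ) * (ccol * x ^ 𝔠.r₀ + 4)) ^ 3) := by rw [hN]; exact hcount
  have hexp := exponent_bound (P4 := P4) (C := C) hcard hC0 hx1 hL0 hccol hr₀ hcount'
  have hfinal : max 1 CRm * Real.exp ((-P4 * (S.card : ℝ) + C * x * N ^ 3) / S.card) ≤
      max 1 CRm * Real.exp (-P4 + 8 * C * (F.L : ℝ) ^ 3 * (ccol + 4) ^ 3 * x ^ (2 + 3 * 𝔠.r₀)) :=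
    mul_le_mul_of_nonneg_left (Real.exp_le_exp.mpr hexp) (le_trans zero_le_one (le_max_left _ _))
  calc (gibbsK F ℰp γ K).real
          {U | θ ≤ GaugeGroup.dist1 (GaugeField.plaqHol (Averaging.iter (fun _ => BlockAveraging.blockAvg ℰp) j U) p)}
        ≤ max 1 CRm * Real.exp (-P4 + 8 * C * (F.L : ℝ) ^ 3 * (ccol + 4) ^ 3 * x ^ (2 + 3 * 𝔠.r₀)) := hroot.trans hfinal
    _ = max 1 CRm * (F.scheme ℰp γ).β (K - j) ^ 0 *
          Real.exp (-(cSF * B10.pFun 𝔠.b₀ 𝔠.p₀ g ^ 2) + 8 * C * (F.L : ℝ) ^ 3 * (ccol + 4) ^ 3 * x ^ (2 + 3 * 𝔠.r₀)) := by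
          rw [pow_zero, mul_one, hP4]

/-- **THE PER-PLAQUETTE HIGH TAIL, THRESHOLD FORM** (v4's `stub_perPlaquetteHighRaw` text with the profile chosen beyond given thresholds): for EVERY odd `L ≥ 3` from
STUB 2′'s records at the profile `(max b₁ b₁′, max p₁ p₁′)` and `perPlaquetteHigh_lane` (no small-block residue). [cite: Balaban1985UV3, (5) p.256 and (71) p.273] -/
theorem perPlaquetteHighL_of_laneRecords (hrec : ∀ L : ℕ, Odd L → 1 < L → Summit.QuantumFields.YangMills.Theorems.AlphaInputsT3ACv3Rec L) :
    ∀ (L : ℕ), Odd L → 1 < L → ∀ (b₁ p₁ : ℝ),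
      ∃ b₀ p₀ r₀ κ c : ℝ, b₁ ≤ b₀ ∧ p₁ ≤ p₀ ∧ 0 < b₀ ∧ 2 < p₀ ∧ 0 ≤ r₀ ∧ 0 ≤ κ ∧ 1 + 3 * r₀ / 2 < p₀ ∧ 0 < c ∧ c ≤ 1 / 4 ∧
        ∃ γ₁ : ℝ, 0 < γ₁ ∧ γ₁ ≤ 1 ∧
          ∀ (F : T3Family) (γ : ℝ), F.L = L → 0 < γ → γ ≤ γ₁ →
            ∃ (j₀ : ℕ) (C : ℝ) (A : ℕ), 0 ≤ C ∧
              ∀ (K j : ℕ), j₀ < j → j ≤ K → ∀ p : Plaq (F.P K) j,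
                (gibbsK F ℰp γ K).real
                    {U | θBal F.L γ b₀ p₀ (K - j) ≤
                      GaugeGroup.dist1 (GaugeField.plaqHol
                        (Averaging.iter (fun _ => BlockAveraging.blockAvg ℰp) j U) p)} ≤
                  C * (F.scheme ℰp γ).β (K - j) ^ A *
                    Real.exp (-(c * B10.pFun b₀ p₀ (Real.sqrt (γ * ((F.L : ℝ)⁻¹) ^ (K - j))) ^ 2) +
                      κ * (1 + Real.log (Real.sqrt (γ * ((F.L : ℝ)⁻¹) ^ (K - j)))⁻¹) ^ (2 + 3 * r₀)) := by
  intro L hLo hL b₁ p₁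
  obtain ⟨b₁', p₁', hrec'⟩ := hrec L hLo hL
  obtain ⟨𝔠, a₀, a₁, hcb, hcp, ha0, ha1, hw, h𝔠⟩ := hrec' (max b₁ b₁') (max p₁ p₁') (le_max_right _ _) (le_max_right _ _)
  obtain ⟨κ, γ₁, c, hκ, hγ₁, hγ₁1, hc0, hc4, hhigh⟩ := perPlaquetteHigh_lane L hLo hL 𝔠 a₀ a₁ ha0 ha1 hw h𝔠
  have hr₀ : 0 ≤ 𝔠.r₀ := zero_le_one.trans 𝔠.one_le_r₀
  have hp : 1 + 3 * 𝔠.r₀ / 2 < 𝔠.p₀ := by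
    have := 𝔠.one_le_r₀
    show 1 + 3 * 𝔠.r₀ / 2 < 2 * 𝔠.r₀ + 1
    linarith
  refine ⟨𝔠.b₀, 𝔠.p₀, 𝔠.r₀, κ, c, hcb ▸ le_max_left _ _, hcp ▸ le_max_left _ _, 𝔠.b₀_pos, 𝔠.two_lt_p₀, hr₀, hκ, hp, hc0, hc4,
    γ₁, hγ₁, hγ₁1, hhigh⟩

/-- **`HistoryTailL ⇐ stub_laneRecordsV3` ALONE** (v5p7: 2″ = the lane's (71) clause at constant `c = 1/8`, PROVED by name from p514512 (`smallFactorLane_v3`); (a) dropped as idle, (c) `PintSize` /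
(d) `Zterm` size / (a)-geometry / 2‴ by name from ★alpha-1's v3 socket, 4a/4c at constant `c` — `HistoryTailHistoryMassWCV3` / `HistoryTailDiluteExponentCV3`, 4b
`HistoryTailLowMassV3`) (+ LANDED: `HistoryTailChessboardT3.chessboardRP_T3` p481363, `HistoryTailBirthV4.stub_budget` p442213 through `budget_of_c`,
`HistoryTailBoundedHeight.perPlaquette_of_split` p438760, `HistoryTailBirthV3b.stub_tailOfPerPlaquette` p432346, `historyTailAt_of_averagedTailAt`) — the v3′ load-bearing
item stmt-QuantumFields-19936 BY NAME; the profile is fixed BEFORE the free top fraction `m`. [cite: Balaban1985UV3, (5) p.256 and (71) p.273; King1986, (3.12) p.657] -/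
theorem historyTailL_of_laneRecords (hrec : ∀ L : ℕ, Odd L → 1 < L → Summit.QuantumFields.YangMills.Theorems.AlphaInputsT3ACv3Rec L) :
    Summit.QuantumFields.YangMills.Theses.UnitScaleTilt.HistoryTailL := by
  intro L b₁ p₁
  by_cases hL : Odd L ∧ 1 < L
  · obtain ⟨b₀, p₀, r₀, κ, cSF, hb1, hp1, hb, hp2, hr₀, hκ, hp, hc0, -, γ₁, hγ₁, hγ₁1, h⟩ := perPlaquetteHighL_of_laneRecords hrec L hL.1 hL.2 b₁ p₁
    obtain ⟨C₆, c, hC₆, hc, hbud⟩ := budget_of_c b₀ p₀ r₀ κ cSF hb hr₀ hκ hp hc0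
    refine ⟨b₀, p₀, hb1, hp1, hb, hp2, fun m hm => ⟨γ₁, hγ₁, fun F γ hFL hγ hle => ?_⟩⟩
    have hγ1 : γ ≤ 1 := hle.trans hγ₁1
    have hp01 : (1 : ℝ) ≤ p₀ := by linarith
    have hL1 : 1 ≤ F.L := F.hL.2.le
    obtain ⟨j₀, C, A, hC, hhigh⟩ := h F γ hFL hγ hle
    have hhigh' : ∃ (C : ℝ) (A : ℕ) (c : ℝ), 0 ≤ C ∧ 0 < c ∧
        ∀ (K j : ℕ), j₀ < j → j ≤ K → ∀ p : Plaq (F.P K) j,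
          (gibbsK F ℰp γ K).real
              {U | θBal F.L γ b₀ p₀ (K - j) ≤
                GaugeGroup.dist1 (GaugeField.plaqHol
                  (Averaging.iter (fun _ => BlockAveraging.blockAvg ℰp) j U) p)} ≤
            C * (F.scheme ℰp γ).β (K - j) ^ A *
              Real.exp (-(c * B10.pFun b₀ p₀ (Real.sqrt (γ * ((F.L : ℝ)⁻¹) ^ (K - j))) ^ 2)) := by
      refine ⟨C * C₆, A, c, mul_nonneg hC hC₆, hc, fun K j hj hjK p => ?_⟩
      have hg := sqrt_coupling_pos_le hL1 hγ (K - j)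
      have hg1 := coupling_le_one hL1 hγ hγ1 (K - j)
      have hβA : 0 ≤ C * (F.scheme ℰp γ).β (K - j) ^ A :=
        mul_nonneg hC (pow_nonneg (F.scheme_β_nonneg ℰp hγ.le (K - j)) A)
      calc (gibbsK F ℰp γ K).real
              {U | θBal F.L γ b₀ p₀ (K - j) ≤
                GaugeGroup.dist1 (GaugeField.plaqHol
                  (Averaging.iter (fun _ => BlockAveraging.blockAvg ℰp) j U) p)}
            ≤ C * (F.scheme ℰp γ).β (K - j) ^ A *
                Real.exp (-(cSF * B10.pFun b₀ p₀ (Real.sqrt (γ * ((F.L : ℝ)⁻¹) ^ (K - j))) ^ 2) +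
                  κ * (1 + Real.log (Real.sqrt (γ * ((F.L : ℝ)⁻¹) ^ (K - j)))⁻¹) ^ (2 + 3 * r₀)) := hhigh K j hj hjK p
        _ ≤ C * (F.scheme ℰp γ).β (K - j) ^ A *
                (C₆ * Real.exp (-(c * B10.pFun b₀ p₀ (Real.sqrt (γ * ((F.L : ℝ)⁻¹) ^ (K - j))) ^ 2))) :=
              mul_le_mul_of_nonneg_left (hbud _ hg.1 hg1) hβA
        _ = C * C₆ * (F.scheme ℰp γ).β (K - j) ^ A *
                Real.exp (-(c * B10.pFun b₀ p₀ (Real.sqrt (γ * ((F.L : ℝ)⁻¹) ^ (K - j))) ^ 2)) := by ring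
    have hPP := HistoryTailBoundedHeight.perPlaquette_of_split j₀ F hγ hγ1 hb.le p₀ hhigh'
    exact historyTailAt_of_averagedTailAt F hγ hγ1 hb hp01 hm
      (HistoryTailBirthV3b.stub_tailOfPerPlaquette F γ b₀ p₀ hγ hγ1 hb hp01 hPP)
  · refine ⟨max b₁ 1, max p₁ 3, le_max_left _ _, le_max_left _ _, lt_of_lt_of_le one_pos (le_max_right _ _),
      lt_of_lt_of_le (by norm_num) (le_max_right _ _), fun m _ => ⟨1, one_pos, fun F γ hFL _ _ => ?_⟩⟩
    have hF := F.hL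
    rw [hFL] at hF
    exact (hL hF).elim

end Summit.QuantumFields.YangMills.Theorems.HistoryTailLaneTail
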